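import Mathlib
import Summits.MatrixMultiplication.MatrixMultiplication.Theses.FourierTwoFamiliesModP
import Summits.MatrixMultiplication.MatrixMultiplication.Theorems.PrimeTwoFamilies.Negative.Slices
import Literature.Computability.AlgebraicComplexity.SimultaneousDoubleProduct
import Summits.MatrixMultiplication.MatrixMultiplication.Theorems.FourierTwoFamiliesModPCyclicReductionTransfer
import Summits.MatrixMultiplication.MatrixMultiplication.Theorems.FourierTwoFamiliesModPPrimeTwoFamiliesStubCapacityTransfer

/-!
# Capacity gadgets vs. `PrimeTwoFamilies` — the explicit slice dictionary
# (crux stmt-MatrixMultiplication-14308, line `Sketch`, capacity-gadget form)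

The capacity-gadget form of the crux (idea `zero-error-capacity-gadgets`) says: for every `ε > 0` and
arbitrarily large `m` there are a gadget of direct pairs `(P c, Q c)_{c<r}` in `ℤ/m` of co-volume
`≥ m^{1-ε}` and a zero-error code `W` of words `Fin L → Fin r` (`L ≥ 1`, every ordered pair of distinct
words strongly separated in some coordinate) of size `≥ (m^L)^{1/2-ε}`.  Its equivalence with CKSU 2005
Conj. 4.7 over prime cyclic hosts (`FourierTwoFamiliesModP.PrimeTwoFamilies`) is the landed theorem
`CapacityLift.capacityGadgets_iff_primeTwoFamilies` (file `…CapacityEquivalences.lean`), which is NOT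
restated here.  This support file records the EXPLICIT, ELEMENTARY exponent dictionary between the
`δ`-slices `PrimeTwoFamiliesAt δ` of the crux and the SINGLE `ε`-levels of the gadget statement, in both
directions (the landed equivalence consumes gadgets at every level at once and produces them through
letter repetition and the `L = 2` self-converse lift):

* `separated_of_cross` — clause (X) of an SDPP family says precisely that DISTINCT LETTERS ARE STRONGLY
  SEPARATED (every cross difference `q - p`, `p ∈ A i`, `q ∈ B k`, `i ≠ k`, avoids every diagonal
  difference `q' - p'`, `p' ∈ A c`, `q' ∈ B c`).
* `gadgets_of_primeTwoFamiliesAt` (⇐, one level, no loss): a slice-`δ` witness `(A i, B i)_{i<n}` in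
  `ℤ/p` IS a capacity gadget at level `m = p` with `r = n` letters, word length `L = 1` and the FULL
  one-letter code `W = univ` (`|W| = n`), at every `ε ≥ δ` (`0 < δ ≤ 1`): `p^{1/2-ε} ≤ n` because
  `p ≤ n^{2+δ}` and `(2+δ)(1/2-ε) ≤ 1`; `p^{1-ε} ≤ n^{2-δ} ≤ |A c||B c|` because `(2+δ)(1-ε) ≤ 2-δ`;
  and `p ≥ |A i||B i| ≥ n^{2-δ} ≥ n` makes the level large.  (The tree's converse
  `CapacityLift.stub_gadgetsOfCrux` + `stub_selfConverse` goes through letter repetition, `r = n²`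
  letters and the `L = 2` self-converse lift; none of that is needed.)
* `primeTwoFamiliesAt_of_gadgetsAt` (⇒, one slice): gadgets at the single level `ε = δ/16` for
  arbitrarily large `m` already give the slice `PrimeTwoFamiliesAt δ` (`0 < δ ≤ 1`): code lift
  (`CapacityLift.capacityTransfer_codeLift`), carry-free transfer into a Bertrand prime
  (`Theorems.exists_prime_sdpp_of_addEquiv`, `p ≤ 2·3^L·m^L`) and the uniform-in-`L` bookkeeping
  `CapacityLift.capacityTransfer_bookkeeping` (`n := max n₀ ⌈p^{1/(2+δ)}⌉₊`).
* a closing `example` (no declaration) checks that the two slice lemmas assemble to the verbatim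
  statement of the capacity-gadget equivalence (slices `δ > 1` by monotonicity `PrimeTwoFamiliesAt.mono`,
  level `ε` from the slice `min ε 1`).

Helper file landed `--supports stmt-MatrixMultiplication-14308` (siege k6, variation explicit /
elementary); no new definitions, all clauses inlined verbatim.
-/

-- single-conjunct summit: the mandated namespace repeats `MatrixMultiplication` (summit = sub-problem).
set_option linter.dupNamespace false

namespace Summit.MatrixMultiplication.MatrixMultiplication.Theorems.PrimeTwoFamilies.CapacityExplicitSlices

open Finset
open Summit.MatrixMultiplication.MatrixMultiplication.Theses
open Summit.MatrixMultiplication.MatrixMultiplication.Theorems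
open Summit.MatrixMultiplication.MatrixMultiplication.Theorems.PrimeTwoFamilies.Negative
open Summit.MatrixMultiplication.MatrixMultiplication.Theorems.PrimeTwoFamilies.CapacityLift
open Literature.Computability.AlgebraicComplexity

/-! ## Clause (X) is strong separation of distinct letters -/

/-- **Clause (X) = strong separation.**  In an SDPP family `(A i, B i)_{i<n}` (clause (X):
`(a - a') + (b - b') = 0` with `a ∈ A i`, `a' ∈ A j`, `b ∈ B j`, `b' ∈ B k` forces `i = k`), two
distinct letters `i ≠ k` are strongly separated: every cross difference `q - p` (`p ∈ A i`, `q ∈ B k`)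
differs from every diagonal difference `q' - p'` (`p' ∈ A c`, `q' ∈ B c`, any `c`).  Indeed
`q - p = q' - p'` is the instance `(p - p') + (q' - q) = 0` of (X) with `(i, j, k) = (i, c, k)`. -/
theorem separated_of_cross {G : Type*} [AddCommGroup G] {n : ℕ} {A B : Fin n → Finset G}
    (hX : ∀ i j k : Fin n, ∀ a ∈ A i, ∀ a' ∈ A j, ∀ b ∈ B j, ∀ b' ∈ B k,
      (a - a') + (b - b') = 0 → i = k)
    {i k : Fin n} (hik : i ≠ k) :
    ∀ p ∈ A i, ∀ q ∈ B k, ∀ c : Fin n, ∀ p' ∈ A c, ∀ q' ∈ B c, q - p ≠ q' - p' := by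
  intro p hp q hq c p' hp' q' hq' h
  refine hik (hX i c k p hp p' hp' q' hq' q hq ?_)
  have e : (p - p') + (q' - q) = (q' - p') - (q - p) := by abel
  rw [e, h, sub_self]

/-! ## (⇐) A slice witness is a one-letter-code gadget, at every level `ε ≥ δ` -/

/-- **Slices give gadgets, explicitly and without loss.**  Let `0 < δ ≤ 1`, `δ ≤ ε`, and let
`PrimeTwoFamiliesAt δ` hold.  Then for every `m₀` there is a capacity gadget at level `ε` in some
`ℤ/m`, `m ≥ m₀`: take a slice witness `(A i, B i)_{i<n}` in `ℤ/p` with `n ≥ max m₀ 1` and put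
`m := p`, `r := n`, `L := 1`, `P := A`, `Q := B`, `W := univ` (all `n` one-letter words).  Directness is
clause (W); the code property is clause (X) (`separated_of_cross`, coordinate `t = 0`); the size bound
`p^{1/2-ε} ≤ n = |W|` follows from `p ≤ n^{2+δ}` and `(2+δ)(1/2-ε) ≤ 1`; the co-volume bound
`p^{1-ε} ≤ n^{2-δ} ≤ |A c||B c|` from `(2+δ)(1-ε) ≤ 2-δ`; and the level is large because
`p ≥ |A i||B i| ≥ n^{2-δ} ≥ n ≥ m₀` ((W) makes `(a, b) ↦ a + b` injective on `A i × B i`). -/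
theorem gadgets_of_primeTwoFamiliesAt {δ ε : ℝ} (hδ : 0 < δ) (hδ1 : δ ≤ 1) (hδε : δ ≤ ε)
    (h : PrimeTwoFamiliesAt δ) (m₀ : ℕ) :
    ∃ m ≥ m₀, ∃ r L : ℕ, ∃ P Q : Fin r → Finset (ZMod m), ∃ W : Finset (Fin L → Fin r),
      (∀ c : Fin r, ∀ x ∈ P c, ∀ x' ∈ P c, ∀ y ∈ Q c, ∀ y' ∈ Q c,
          (x - x') + (y - y') = 0 → x = x' ∧ y = y') ∧
      (∀ i ∈ W, ∀ k ∈ W, i ≠ k → ∃ t : Fin L,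
        ∀ p ∈ P (i t), ∀ q ∈ Q (k t), ∀ c : Fin r, ∀ p' ∈ P c, ∀ q' ∈ Q c, q - p ≠ q' - p') ∧
      1 ≤ L ∧
      ((m : ℝ) ^ (L : ℝ)) ^ (1 / 2 - ε) ≤ (W.card : ℝ) ∧
      ∀ c : Fin r, (m : ℝ) ^ (1 - ε) ≤ (((P c).card * (Q c).card : ℕ) : ℝ) := by
  obtain ⟨n, hn, p, hp, A, B, hW, hX, hpn, hAB⟩ := h (max m₀ 1)
  have hn1 : 1 ≤ n := le_trans (le_max_right _ _) hn
  have hn1R : (1 : ℝ) ≤ n := by exact_mod_cast hn1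
  haveI : Fact p.Prime := ⟨hp⟩
  have hp1R : (1 : ℝ) ≤ p := by exact_mod_cast hp.one_lt.le
  -- the level is large: `n ≤ n^{2-δ} ≤ |A i||B i| ≤ p`
  have hnp : n ≤ p := by
    have i : Fin n := ⟨0, by omega⟩
    have h1 : (A i).card * (B i).card ≤ p := by
      have := card_mul_card_le_of_dpp (H := ZMod p) (hW i)
      rwa [ZMod.card] at this
    have h2 : (n : ℝ) ≤ (n : ℝ) ^ (2 - δ) := by
      calc (n : ℝ) = (n : ℝ) ^ (1 : ℝ) := (Real.rpow_one _).symm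
        _ ≤ (n : ℝ) ^ (2 - δ) := Real.rpow_le_rpow_of_exponent_le hn1R (by linarith)
    have h3 : (n : ℝ) ≤ p := h2.trans ((hAB i).trans (by exact_mod_cast h1))
    exact_mod_cast h3
  have hδε0 : 0 ≤ δ * ε := mul_nonneg hδ.le (hδ.le.trans hδε)
  refine ⟨p, le_trans (le_max_left _ _) (hn.trans hnp), n, 1, A, B, Finset.univ, hW, ?_, le_rfl,
    ?_, ?_⟩
  · -- the full one-letter code: distinct constant words are separated at `t = 0` by clause (X)
    intro i _ k _ hik
    refine ⟨0, separated_of_cross hX fun h0 => hik ?_⟩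
    funext t
    rw [Fin.fin_one_eq_zero t]
    exact h0
  · -- code size: `(p ^ 1) ^ (1/2 - ε) ≤ n = |W|`
    have hWcard : ((Finset.univ : Finset (Fin 1 → Fin n)).card : ℝ) = n := by
      rw [Finset.card_univ, Fintype.card_fun, Fintype.card_fin, Fintype.card_fin, pow_one]
    rw [hWcard, Nat.cast_one, Real.rpow_one]
    rcases le_or_gt 0 (1 / 2 - ε) with hε | hε
    · calc (p : ℝ) ^ (1 / 2 - ε) ≤ ((n : ℝ) ^ (2 + δ)) ^ (1 / 2 - ε) :=
            Real.rpow_le_rpow (Nat.cast_nonneg _) hpn hε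
        _ = (n : ℝ) ^ ((2 + δ) * (1 / 2 - ε)) := (Real.rpow_mul (Nat.cast_nonneg _) _ _).symm
        _ ≤ (n : ℝ) ^ (1 : ℝ) := Real.rpow_le_rpow_of_exponent_le hn1R (by nlinarith)
        _ = n := Real.rpow_one _
    · calc (p : ℝ) ^ (1 / 2 - ε) ≤ 1 := Real.rpow_le_one_of_one_le_of_nonpos hp1R hε.le
        _ ≤ n := hn1R
  · -- co-volume: `p ^ (1 - ε) ≤ n ^ (2 - δ) ≤ |A c||B c|`
    intro c
    refine le_trans ?_ (hAB c)
    rcases le_or_gt 0 (1 - ε) with hε | hε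
    · calc (p : ℝ) ^ (1 - ε) ≤ ((n : ℝ) ^ (2 + δ)) ^ (1 - ε) :=
            Real.rpow_le_rpow (Nat.cast_nonneg _) hpn hε
        _ = (n : ℝ) ^ ((2 + δ) * (1 - ε)) := (Real.rpow_mul (Nat.cast_nonneg _) _ _).symm
        _ ≤ (n : ℝ) ^ (2 - δ) := Real.rpow_le_rpow_of_exponent_le hn1R (by nlinarith)
    · calc (p : ℝ) ^ (1 - ε) ≤ 1 := Real.rpow_le_one_of_one_le_of_nonpos hp1R hε.le
        _ ≤ (n : ℝ) ^ (2 - δ) := Real.one_le_rpow hn1R (by linarith)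

/-! ## (⇒) Gadgets at the single level `ε = δ/16` give the slice `δ` -/

/-- **One gadget level gives one slice, explicitly.**  Let `0 < δ ≤ 1`.  If for arbitrarily large `m`
there are a gadget of direct pairs `(P c, Q c)_{c<r}` in `ℤ/m` of co-volume `≥ m^{1-δ/16}` and a
zero-error code `W` of words `Fin L → Fin r` (`L ≥ 1`) of size `≥ (m^L)^{1/2-δ/16}`, then
`PrimeTwoFamiliesAt δ`.  Proof (the composition of lead -1's `stub_capacityTransfer`, run at ONE level):
take `m ≥ max m₀ 1` with `m₀` from `capacityTransfer_bookkeeping hδ hδ1 n₀`; enumerate `W` by `Fin |W|`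
and lift (`capacityTransfer_codeLift`) to `|W|` SDPP blocks `∏ₜ P (w t)`, `∏ₜ Q (w t)` in `Fin L → ℤ/m`;
move them into a prime `p ≤ 2·3^L·m^L` keeping sizes (`exists_prime_sdpp_of_addEquiv`, `k = L`
factors `ℤ/m`); keep the first `n` blocks, `n₀ ≤ n ≤ |W|`, `p ≤ n^{2+δ}`, `n^{2-δ} ≤ (m^{1-δ/16})^L`. -/
theorem primeTwoFamiliesAt_of_gadgetsAt {δ : ℝ} (hδ : 0 < δ) (hδ1 : δ ≤ 1)
    (h : ∀ m₀ : ℕ, ∃ m ≥ m₀, ∃ r L : ℕ, ∃ P Q : Fin r → Finset (ZMod m),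
      ∃ W : Finset (Fin L → Fin r),
        (∀ c : Fin r, ∀ x ∈ P c, ∀ x' ∈ P c, ∀ y ∈ Q c, ∀ y' ∈ Q c,
            (x - x') + (y - y') = 0 → x = x' ∧ y = y') ∧
        (∀ i ∈ W, ∀ k ∈ W, i ≠ k → ∃ t : Fin L,
          ∀ p ∈ P (i t), ∀ q ∈ Q (k t), ∀ c : Fin r, ∀ p' ∈ P c, ∀ q' ∈ Q c, q - p ≠ q' - p') ∧
        1 ≤ L ∧
        ((m : ℝ) ^ (L : ℝ)) ^ (1 / 2 - δ / 16) ≤ (W.card : ℝ) ∧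
        ∀ c : Fin r, (m : ℝ) ^ (1 - δ / 16) ≤ (((P c).card * (Q c).card : ℕ) : ℝ)) :
    PrimeTwoFamiliesAt δ := by
  -- adapted from `CapacityLift.stub_capacityTransfer` (Theorems/…StubCapacityTransfer.lean), one level
  classical
  intro n₀
  obtain ⟨m₀, hm₀⟩ := capacityTransfer_bookkeeping hδ hδ1 n₀
  obtain ⟨m, hm, r, L, P, Q, W, hD, hC, hL, hWcard, hPQ⟩ := h (max m₀ 1)
  have hm₀m : m₀ ≤ m := le_trans (le_max_left _ _) hm
  have hm1 : 1 ≤ m := le_trans (le_max_right _ _) hm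
  -- the code and its enumeration
  set N : ℕ := W.card with hN
  let e : W ≃ Fin N := W.equivFin
  -- the lifted family, indexed by `Fin N`
  let A : Fin N → Finset (Fin L → ZMod m) :=
    fun i => Fintype.piFinset (fun t => P ((e.symm i : Fin L → Fin r) t))
  let B : Fin N → Finset (Fin L → ZMod m) :=
    fun i => Fintype.piFinset (fun t => Q ((e.symm i : Fin L → Fin r) t))
  obtain ⟨hW1, hX1⟩ := capacityTransfer_codeLift P Q hD W hC
  have hWA : ∀ i : Fin N, ∀ a ∈ A i, ∀ a' ∈ A i, ∀ b ∈ B i, ∀ b' ∈ B i,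
      (a - a') + (b - b') = 0 → a = a' ∧ b = b' :=
    fun i => hW1 _ (e.symm i).2
  have hXA : ∀ i j k : Fin N, ∀ a ∈ A i, ∀ a' ∈ A j, ∀ b ∈ B j, ∀ b' ∈ B k,
      (a - a') + (b - b') = 0 → i = k := by
    intro i j k a ha a' ha' b hb b' hb' h0
    have hik := hX1 _ (e.symm i).2 _ (e.symm j).2 _ (e.symm k).2 a ha a' ha' b hb b' hb' h0
    exact e.symm.injective (Subtype.ext hik)
  -- transfer into a prime cyclic host (route support CyclicReduction, transfer step)
  obtain ⟨p, hp, hpR, A', B', hcard, hW', hX'⟩ :=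
    exists_prime_sdpp_of_addEquiv hWA hXA (m := fun _ : Fin L => m) (fun _ => hm1)
      (AddEquiv.refl (Fin L → ZMod m))
  rw [Fin.prod_const] at hpR
  -- the number of pairs kept
  obtain ⟨n, hn₀, hnN, hpn, hnP⟩ := hm₀ m hm₀m L hL N hWcard p hpR
  refine ⟨n, hn₀, p, hp, A' ∘ Fin.castLE hnN, B' ∘ Fin.castLE hnN, ?_, ?_, hpn, ?_⟩
  · intro i
    exact hW' (Fin.castLE hnN i)
  · intro i j k a ha a' ha' b hb b' hb' h0
    exact Fin.castLE_injective hnN (hX' _ _ _ a ha a' ha' b hb b' hb' h0)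
  · intro i
    have hci := hcard (Fin.castLE hnN i)
    simp only [Function.comp_apply]
    rw [hci.1, hci.2]
    simp only [A, B, Fintype.card_piFinset]
    rw [← Finset.prod_mul_distrib]
    refine hnP.trans ?_
    rw [← Fin.prod_const]
    push_cast
    refine Finset.prod_le_prod (fun t _ => by positivity) fun t _ => ?_
    exact_mod_cast hPQ _

/-! ## Assembly check (an `example`, deliberately no declaration)

The capacity-gadget equivalence itself is the landed `CapacityLift.capacityGadgets_iff_primeTwoFamilies`;
the following `example` only certifies that the explicit dictionary above assembles to its verbatim
statement: (⇒) slice `0 < δ ≤ 1` from the single gadget level `ε = δ/16`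
(`primeTwoFamiliesAt_of_gadgetsAt`), slices `δ > 1` by monotonicity from `δ = 1`; (⇐) level `ε` from the
single slice `δ = min ε 1` by the one-letter code (`gadgets_of_primeTwoFamiliesAt`). -/

example :
    (∀ ε : ℝ, 0 < ε → ∀ m₀ : ℕ, ∃ m ≥ m₀, ∃ r L : ℕ, ∃ P Q : Fin r → Finset (ZMod m),
      ∃ W : Finset (Fin L → Fin r),
      (∀ c : Fin r, ∀ x ∈ P c, ∀ x' ∈ P c, ∀ y ∈ Q c, ∀ y' ∈ Q c,
          (x - x') + (y - y') = 0 → x = x' ∧ y = y') ∧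
      (∀ i ∈ W, ∀ k ∈ W, i ≠ k → ∃ t : Fin L,
        ∀ p ∈ P (i t), ∀ q ∈ Q (k t), ∀ c : Fin r, ∀ p' ∈ P c, ∀ q' ∈ Q c, q - p ≠ q' - p') ∧
      1 ≤ L ∧
      ((m : ℝ) ^ (L : ℝ)) ^ (1 / 2 - ε) ≤ (W.card : ℝ) ∧
      ∀ c : Fin r, (m : ℝ) ^ (1 - ε) ≤ (((P c).card * (Q c).card : ℕ) : ℝ)) ↔
    FourierTwoFamiliesModP.PrimeTwoFamilies := by
  rw [primeTwoFamilies_iff]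
  refine ⟨fun hC δ hδ => ?_, fun hT ε hε m₀ => ?_⟩
  · -- (⇒): one gadget level per slice
    by_cases h1 : δ ≤ 1
    · exact primeTwoFamiliesAt_of_gadgetsAt hδ h1 (hC (δ / 16) (by positivity))
    · exact (primeTwoFamiliesAt_of_gadgetsAt one_pos le_rfl (hC (1 / 16) (by norm_num))).mono
        (le_of_not_ge h1)
  · -- (⇐): the slice `min ε 1` is a one-letter-code gadget at level `ε`
    exact gadgets_of_primeTwoFamiliesAt (lt_min hε one_pos) (min_le_right ε 1) (min_le_left ε 1)
      (hT (min ε 1) (lt_min hε one_pos)) m₀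

end Summit.MatrixMultiplication.MatrixMultiplication.Theorems.PrimeTwoFamilies.CapacityExplicitSlices
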